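import Literature.RepresentationTheory.KashiwaraVergne1978.PluriharmonicPolynomials

/-!
# Kashiwara–Vergne (1978), Ch. III §5, `k = 1` (continued): the pluriharmonic polynomials are
# `K[x] + K[y]`, and the torus part / the differential of `τ(λ)` of (5.5)

Companion of `Literature.RepresentationTheory.KashiwaraVergne1978.PluriharmonicPolynomials` (same
source, same conventions: `MvPolynomial (ιx ⊕ ιy) K`, `x_i = X (inl i)`, `y_j = X (inr j)`, `k = 1`).

* §1 — for `k = 1` and `K` of characteristic `0`, a polynomial is pluriharmonic ((5.1):
  `∂²f/∂x_i∂y_j = 0` for all `i, j`) iff each of its monomials is free of `x` or free of `y`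
  (`isPluriharmonic_iff_support`), i.e. **`𝔥 = K[x] + K[y]`** (`harmonics_eq_sup`, with Mathlib's
  `MvPolynomial.supported`).  Tool: the Euler operators `X_u ∂/∂X_u` are diagonal on monomials
  (`coeff_X_mul_pderiv`) and `x_i y_j Δ_{ij} = (x_i∂_{x_i})(y_j∂_{y_j})`.  Consequently KV's set `Σ`
  of (5.5) ("the subset of `λ ∈ U(k)^` such that `𝔥(λ) ≠ 0`") is, for `k = 1`, read off from the
  weights of pure monomials (§3 below) — cf. Thm (6.3)(a) with `i + j ≤ k = 1`.
* §2 — **(5.5)** p. 42, verbatim: "For `λ ∈ Σ` we denote by `τ(λ)` the representation of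
  `GL(p,ℂ) × GL(q,ℂ)` on `𝔥(λ)` given by `((g₁, g₂)·P)(x, y) = P(g₁⁻¹x, ᵗg₂y)`."  Transcribed: the
  TORUS part `kvTauTorus t s : P ↦ P(diag(t)⁻¹x, diag(s)y)` with its character on monomials
  (`kvTauTorus_monomial`: `x^α y^β ↦ t^{−α} s^{β}`), and the DIFFERENTIAL
  `kvTauDiff E H = −Σ_{a,b} E_{ab} x_b∂_{x_a} + Σ_{a,b} H_{ab} y_a∂_{y_b}` (`= d/dt|₀` of
  `P(e^{−tE}x, ᵗ(e^{tH})y)`; the derivative itself is not formalised) with its diagonal eigenvalues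
  (`kvTauDiff_diagonal_monomial`).  The full `GL(p) × GL(q)`-action, Prop. (5.6) (irreducibility)
  and the highest weights of §6 are NOT here.
* §3 — KV's `Σ` of (5.5) for `k = 1`, as theorems about the pieces: `𝔥 ∩ ℂ[X](λ_{−d})` is
  `K[x] ∩ piece d` for `d > 0`, `K[y] ∩ piece d` for `d < 0`, and the constants for `d = 0`
  (`harmonics_inf_piece_eq_of_pos/_of_neg`, `harmonics_inf_piece_zero`; characteristic `0`), and
  every piece is non-zero when `ιx`, `ιy` are nonempty (`harmonics_inf_piece_ne_bot`: `Σ = ℤ` for `k = 1`,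
  Thm (6.3)(a) p. 44 at `k = 1`).

Source: M. Kashiwara, M. Vergne, Invent. Math. **44** (1978) 1–47, Ch. III (5.1), (5.5), pp. 41–42
[KashiwaraVergne1978], read on the GDZ page images.

## References
* M. Kashiwara, M. Vergne, Invent. Math. 44 (1978) 1–47, Ch. III §5. [KashiwaraVergne1978]
-/

namespace Literature.RepresentationTheory.KashiwaraVergne1978

open _root_.MvPolynomial _root_.Finsupp

open scoped BigOperators

namespace KVPoly

variable {K : Type*} [Field K] {ιx ιy : Type*}

/-! ## §1. `k = 1`: the pluriharmonic polynomials are `K[x] + K[y]` (characteristic `0`) -/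

/-- The Euler-type operator `X_v · ∂/∂X_u` has `X_u∂/∂X_u` diagonal on monomials:
`coeff_m (X_u ∂_u f) = m_u · coeff_m f`. [cite: KashiwaraVergne1978, III (5.5), p. 42] -/
theorem coeff_X_mul_pderiv (u : ιx ⊕ ιy) (f : MvPolynomial (ιx ⊕ ιy) K) (m : ιx ⊕ ιy →₀ ℕ) :
    coeff m (X u * pderiv u f) = m u • coeff m f := by
  classical
  induction f using MvPolynomial.induction_on' with
  | monomial m' r =>
    rw [X_mul_pderiv_monomial, coeff_smul, coeff_monomial]
    split_ifs with h
    · rw [h]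
    · rw [smul_zero, smul_zero]
  | add p q hp hq => rw [map_add, mul_add, coeff_add, coeff_add, hp, hq, smul_add]

/-- In characteristic `0`: a monomial occurring in a pluriharmonic polynomial cannot contain both some
`x_i` and some `y_j` (apply `x_i y_j Δ_{ij} = (x_i∂_{x_i})(y_j∂_{y_j})`, diagonal with eigenvalue
`α_i β_j` on `x^α y^β`). [cite: KashiwaraVergne1978, III (5.1), p. 41] -/
theorem IsPluriharmonic.apply_inl_eq_zero_or [CharZero K] {f : MvPolynomial (ιx ⊕ ιy) K}
    (hf : IsPluriharmonic f) {m : ιx ⊕ ιy →₀ ℕ} (hm : m ∈ f.support) (i : ιx) (j : ιy) :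
    m (Sum.inl i) = 0 ∨ m (Sum.inr j) = 0 := by
  have h1 : X (Sum.inl i) * pderiv (Sum.inl i) (X (Sum.inr j) * pderiv (Sum.inr j) f) =
      X (Sum.inl i) * X (Sum.inr j) * kvDelta i j f := by
    rw [kvDelta_apply, pderiv_mul, pderiv_X_of_ne (Sum.inr_ne_inl), zero_mul, zero_add, mul_assoc]
  have h2 := coeff_X_mul_pderiv (Sum.inl i) (X (Sum.inr j) * pderiv (Sum.inr j) f) m
  rw [coeff_X_mul_pderiv (Sum.inr j) f m, smul_smul, h1, hf i j, mul_zero, coeff_zero, eq_comm,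
    nsmul_eq_mul, mul_eq_zero, Nat.cast_eq_zero, Nat.mul_eq_zero] at h2
  rcases h2 with (h | h) | h
  · exact Or.inl h
  · exact Or.inr h
  · exact absurd h (MvPolynomial.mem_support_iff.mp hm)

/-- In characteristic `0`, `f` is pluriharmonic iff every monomial of `f` is free of `x` or free of
`y` (`k = 1`). [cite: KashiwaraVergne1978, III (5.1), p. 41] -/
theorem isPluriharmonic_iff_support [CharZero K] (f : MvPolynomial (ιx ⊕ ιy) K) :
    IsPluriharmonic f ↔ ∀ m ∈ f.support, (∀ i, m (Sum.inl i) = 0) ∨ (∀ j, m (Sum.inr j) = 0) := by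
  refine ⟨fun hf m hm => ?_, IsPluriharmonic.of_support⟩
  by_cases hx : ∀ i, m (Sum.inl i) = 0
  · exact Or.inl hx
  · obtain ⟨i, hi⟩ := not_forall.mp hx
    exact Or.inr fun j => (hf.apply_inl_eq_zero_or hm i j).resolve_left hi

/-- `f ∈ K[x]` (Mathlib: `supported K (range inl)`) iff no monomial of `f` contains a `y_j`.
[cite: KashiwaraVergne1978, III (5.1), p. 41] -/
theorem mem_supported_range_inl_iff (f : MvPolynomial (ιx ⊕ ιy) K) :
    f ∈ supported K (Set.range (Sum.inl : ιx → ιx ⊕ ιy)) ↔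
      ∀ m ∈ f.support, ∀ j, m (Sum.inr j) = 0 := by
  rw [MvPolynomial.mem_supported]
  constructor
  · intro h m hm j
    by_contra hne
    obtain ⟨i, hi⟩ := h ((mem_vars_iff_mem_support _).2 ⟨m, hm, Finsupp.mem_support_iff.2 hne⟩)
    exact Sum.inl_ne_inr hi
  · rintro h v hv
    obtain ⟨m, hm, hv'⟩ := (mem_vars_iff_mem_support v).1 hv
    rcases v with i | j
    · exact ⟨i, rfl⟩
    · exact absurd (h m hm j) (Finsupp.mem_support_iff.1 hv')

/-- `f ∈ K[y]` (Mathlib: `supported K (range inr)`) iff no monomial of `f` contains an `x_i`.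
[cite: KashiwaraVergne1978, III (5.1), p. 41] -/
theorem mem_supported_range_inr_iff (f : MvPolynomial (ιx ⊕ ιy) K) :
    f ∈ supported K (Set.range (Sum.inr : ιy → ιx ⊕ ιy)) ↔
      ∀ m ∈ f.support, ∀ i, m (Sum.inl i) = 0 := by
  rw [MvPolynomial.mem_supported]
  constructor
  · intro h m hm i
    by_contra hne
    obtain ⟨j, hj⟩ := h ((mem_vars_iff_mem_support _).2 ⟨m, hm, Finsupp.mem_support_iff.2 hne⟩)
    exact Sum.inr_ne_inl hj
  · rintro h v hv
    obtain ⟨m, hm, hv'⟩ := (mem_vars_iff_mem_support v).1 hv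
    rcases v with i | j
    · exact absurd (h m hm i) (Finsupp.mem_support_iff.1 hv')
    · exact ⟨j, rfl⟩

/-- **`𝔥 = K[x] + K[y]` for `k = 1`** (characteristic `0`): the pluriharmonic polynomials are exactly
the sums of a polynomial in the `x_i` alone and a polynomial in the `y_j` alone.
[cite: KashiwaraVergne1978, III (5.1)–(5.2), pp. 41–42] -/
theorem harmonics_eq_sup [CharZero K] :
    (harmonics : Submodule K (MvPolynomial (ιx ⊕ ιy) K)) =
      Subalgebra.toSubmodule (supported K (Set.range (Sum.inl : ιx → ιx ⊕ ιy))) ⊔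
        Subalgebra.toSubmodule (supported K (Set.range (Sum.inr : ιy → ιx ⊕ ιy))) := by
  classical
  apply le_antisymm
  · intro f hf
    rw [mem_harmonics_iff, isPluriharmonic_iff_support] at hf
    rw [f.as_sum]
    refine Submodule.sum_mem _ fun m hm => ?_
    rcases hf m hm with hx | hy
    · refine Submodule.mem_sup_right ((mem_supported_range_inr_iff _).2 fun m' hm' i => ?_)
      rw [Finset.mem_singleton.mp (support_monomial_subset hm')]
      exact hx i
    · refine Submodule.mem_sup_left ((mem_supported_range_inl_iff _).2 fun m' hm' j => ?_)
      rw [Finset.mem_singleton.mp (support_monomial_subset hm')]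
      exact hy j
  · refine sup_le (fun f hf => ?_) (fun f hf => ?_)
    · exact (mem_harmonics_iff f).2 (IsPluriharmonic.of_support fun m hm =>
        Or.inr ((mem_supported_range_inl_iff f).1 hf m hm))
    · exact (mem_harmonics_iff f).2 (IsPluriharmonic.of_support fun m hm =>
        Or.inl ((mem_supported_range_inr_iff f).1 hf m hm))

/-! ## §2. (5.5): the torus part and the differential of `τ(λ)`, `((g₁,g₂)·P)(x,y) = P(g₁⁻¹x, ᵗg₂y)` -/

/-- The rescaling of (5.5) for DIAGONAL `g₁ = diag(t)`, `g₂ = diag(s)`: `x_a ↦ t_a⁻¹ x_a`,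
`y_b ↦ s_b y_b`. [cite: KashiwaraVergne1978, III (5.5), p. 42] -/
def tauScale (t : ιx → Kˣ) (s : ιy → Kˣ) : ιx ⊕ ιy → K :=
  Sum.elim (fun a => (((t a)⁻¹ : Kˣ) : K)) (fun b => (s b : K))

/-- **KV78 III (5.5)** on the torus: `P ↦ P(diag(t)⁻¹ x, diag(s) y)`.
[cite: KashiwaraVergne1978, III (5.5), p. 42] -/
noncomputable def kvTauTorus (t : ιx → Kˣ) (s : ιy → Kˣ) :
    MvPolynomial (ιx ⊕ ιy) K →ₐ[K] MvPolynomial (ιx ⊕ ιy) K :=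
  aeval fun v => tauScale t s v • (X v : MvPolynomial (ιx ⊕ ιy) K)

/-- `τ`-weights of a monomial: `P(diag(t)⁻¹x, diag(s)y) = (∏_a t_a^{−α_a}) (∏_b s_b^{β_b}) · P` for
`P = x^α y^β` — the torus character `(−α; β)`. [cite: KashiwaraVergne1978, III (5.5), p. 42] -/
theorem kvTauTorus_monomial [Fintype ιx] [Fintype ιy] (t : ιx → Kˣ) (s : ιy → Kˣ)
    (m : ιx ⊕ ιy →₀ ℕ) (r : K) :
    kvTauTorus t s (monomial m r) =
      ((∏ a, (((t a)⁻¹ : Kˣ) : K) ^ m (Sum.inl a)) * ∏ b, (s b : K) ^ m (Sum.inr b)) •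
        monomial m r := by
  rw [kvTauTorus, aeval_smul_X_monomial]
  congr 1
  exact prod_pow_sum_elim _ _ m

/-- The Euler-type operators `X_u ∂/∂X_v` (the differential of (5.5) is a combination of these).
[cite: KashiwaraVergne1978, III (5.5), p. 42] -/
noncomputable def eulerOp (u v : ιx ⊕ ιy) :
    MvPolynomial (ιx ⊕ ιy) K →ₗ[K] MvPolynomial (ιx ⊕ ιy) K where
  toFun f := X u * pderiv v f
  map_add' f g := by simp only [map_add, mul_add]
  map_smul' r f := by simp only [Derivation.map_smul, RingHom.id_apply, mul_smul_comm]

/-- Unfolding of `eulerOp`. [cite: KashiwaraVergne1978, III (5.5), p. 42] -/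
theorem eulerOp_apply (u v : ιx ⊕ ιy) (f : MvPolynomial (ιx ⊕ ιy) K) :
    eulerOp u v f = X u * pderiv v f := rfl

/-- `X_u∂_u` is diagonal on monomials with eigenvalue `m_u`.
[cite: KashiwaraVergne1978, III (5.5), p. 42] -/
theorem eulerOp_self_monomial (u : ιx ⊕ ιy) (m : ιx ⊕ ιy →₀ ℕ) (r : K) :
    eulerOp u u (monomial m r) = (m u : K) • monomial m r := by
  rw [eulerOp_apply, X_mul_pderiv_monomial, Nat.cast_smul_eq_nsmul]

/-- **The differential of (5.5)** at `(E, H) ∈ 𝔤𝔩(ιx) ⊕ 𝔤𝔩(ιy)`: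
`d/dt|_{t=0} P(e^{−tE}x, ᵗ(e^{tH})y) = −Σ_{a,b} E_{ab} x_b ∂_{x_a}P + Σ_{a,b} H_{ab} y_a ∂_{y_b}P`
(the derivative itself is not formalised; this is the resulting first-order operator).
[cite: KashiwaraVergne1978, III (5.5), p. 42] -/
noncomputable def kvTauDiff [Fintype ιx] [Fintype ιy] (E : Matrix ιx ιx K) (H : Matrix ιy ιy K) :
    Module.End K (MvPolynomial (ιx ⊕ ιy) K) :=
  -(∑ a, ∑ b, E a b • (eulerOp (Sum.inl b) (Sum.inl a) : Module.End K (MvPolynomial (ιx ⊕ ιy) K))) +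
    ∑ a, ∑ b, H a b • (eulerOp (Sum.inr a) (Sum.inr b) : Module.End K (MvPolynomial (ιx ⊕ ιy) K))

/-- Diagonal case on monomials: `kvTauDiff (diag t) (diag s)` multiplies `x^α y^β` by
`−Σ_a t_a α_a + Σ_b s_b β_b` — the infinitesimal form of the torus character of `kvTauTorus_monomial`.
[cite: KashiwaraVergne1978, III (5.5), p. 42] -/
theorem kvTauDiff_diagonal_monomial [Fintype ιx] [Fintype ιy] [DecidableEq ιx] [DecidableEq ιy]
    (t : ιx → K) (s : ιy → K) (m : ιx ⊕ ιy →₀ ℕ) (r : K) :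
    kvTauDiff (Matrix.diagonal t) (Matrix.diagonal s) (monomial m r) =
      (-(∑ a, t a * m (Sum.inl a)) + ∑ b, s b * m (Sum.inr b)) • monomial m r := by
  have hx : ∀ a : ιx, (∑ b, Matrix.diagonal t a b •
      (eulerOp (Sum.inl b) (Sum.inl a) : Module.End K (MvPolynomial (ιx ⊕ ιy) K))) (monomial m r) =
        (t a * m (Sum.inl a)) • monomial m r := by
    intro a
    rw [Finset.sum_eq_single a (fun b _ hb => by rw [Matrix.diagonal_apply_ne _ (Ne.symm hb), zero_smul])
      (fun h => absurd (Finset.mem_univ a) h), Matrix.diagonal_apply_eq, LinearMap.smul_apply,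
      eulerOp_self_monomial, smul_smul]
  have hy : ∀ a : ιy, (∑ b, Matrix.diagonal s a b •
      (eulerOp (Sum.inr a) (Sum.inr b) : Module.End K (MvPolynomial (ιx ⊕ ιy) K))) (monomial m r) =
        (s a * m (Sum.inr a)) • monomial m r := by
    intro a
    rw [Finset.sum_eq_single a (fun b _ hb => by rw [Matrix.diagonal_apply_ne _ (Ne.symm hb), zero_smul])
      (fun h => absurd (Finset.mem_univ a) h), Matrix.diagonal_apply_eq, LinearMap.smul_apply,
      eulerOp_self_monomial, smul_smul]
  rw [kvTauDiff, LinearMap.add_apply, LinearMap.neg_apply, LinearMap.sum_apply, LinearMap.sum_apply,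
    Finset.sum_congr rfl fun a _ => hx a, Finset.sum_congr rfl fun a _ => hy a, ← Finset.sum_smul,
    ← Finset.sum_smul, ← neg_smul, ← add_smul]

/-! ## §3. `Σ` for `k = 1`: the non-zero pieces `𝔥(λ)` ((5.5) "the subset of `λ ∈ U(k)^` such that `𝔥(λ) ≠ 0`") -/

/-- The weight of a monomial free of `x` is minus its degree.
[cite: KashiwaraVergne1978, III (5.2), p. 42] -/
theorem weight_eq_neg_degree_of_inl (m : ιx ⊕ ιy →₀ ℕ) (h : ∀ i, m (Sum.inl i) = 0) :
    weight kvWeight m = -((m.degree : ℕ) : ℤ) := by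
  rw [weight_apply, Finsupp.sum, degree_apply, Nat.cast_sum, ← Finset.sum_neg_distrib]
  refine Finset.sum_congr rfl fun v hv => ?_
  rcases v with i | j
  · exact absurd (h i) (Finsupp.mem_support_iff.1 hv)
  · simp

/-- The weight of a monomial free of `y` is its degree.
[cite: KashiwaraVergne1978, III (5.2), p. 42] -/
theorem weight_eq_degree_of_inr (m : ιx ⊕ ιy →₀ ℕ) (h : ∀ j, m (Sum.inr j) = 0) :
    weight kvWeight m = ((m.degree : ℕ) : ℤ) := by
  rw [weight_apply, Finsupp.sum, degree_apply, Nat.cast_sum]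
  refine Finset.sum_congr rfl fun v hv => ?_
  rcases v with i | j
  · simp
  · exact absurd (h j) (Finsupp.mem_support_iff.1 hv)

/-- **`𝔥(λ)` for `k = 1`, positive weight**: for `d > 0`, `𝔥 ∩ ℂ[X](λ_{−d})` is the space of
polynomials in the `x_i` alone lying in the piece `d` (i.e. homogeneous of degree `d` in `x`) — KV's
`τ(λ) = τ₁(0,…,0,−d) ⊗ τ₂(0)` line of Thm (6.3)(b) at `k = 1` (highest weights not typed).
[cite: KashiwaraVergne1978, III (5.5), p. 42] -/
theorem harmonics_inf_piece_eq_of_pos [CharZero K] {d : ℤ} (hd : 0 < d) :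
    harmonics ⊓ piece (K := K) d =
      Subalgebra.toSubmodule (supported K (Set.range (Sum.inl : ιx → ιx ⊕ ιy))) ⊓ piece (K := K) d := by
  apply le_antisymm
  · rintro f ⟨hh, hp⟩
    refine ⟨(mem_supported_range_inl_iff f).2 fun m hm j => ?_, hp⟩
    have hw : weight kvWeight m = d := hp (MvPolynomial.mem_support_iff.mp hm)
    rcases ((isPluriharmonic_iff_support f).1 ((mem_harmonics_iff f).1 hh)) m hm with hx | hy
    · exfalso
      have h' := weight_eq_neg_degree_of_inl m hx
      omega
    · exact hy j
  · rintro f ⟨hx, hp⟩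
    exact ⟨harmonics_eq_sup (K := K) (ιx := ιx) (ιy := ιy) ▸ Submodule.mem_sup_left hx, hp⟩

/-- **`𝔥(λ)` for `k = 1`, negative weight**: for `d < 0`, `𝔥 ∩ ℂ[X](λ_{−d})` is the space of
polynomials in the `y_j` alone lying in the piece `d` (homogeneous of degree `−d` in `y`) — KV's
`τ(λ) = τ₁(0) ⊗ τ₂(−d,0,…,0)` line of Thm (6.3)(b) at `k = 1` (highest weights not typed).
[cite: KashiwaraVergne1978, III (5.5), p. 42] -/
theorem harmonics_inf_piece_eq_of_neg [CharZero K] {d : ℤ} (hd : d < 0) :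
    harmonics ⊓ piece (K := K) d =
      Subalgebra.toSubmodule (supported K (Set.range (Sum.inr : ιy → ιx ⊕ ιy))) ⊓ piece (K := K) d := by
  apply le_antisymm
  · rintro f ⟨hh, hp⟩
    refine ⟨(mem_supported_range_inr_iff f).2 fun m hm i => ?_, hp⟩
    have hw : weight kvWeight m = d := hp (MvPolynomial.mem_support_iff.mp hm)
    rcases ((isPluriharmonic_iff_support f).1 ((mem_harmonics_iff f).1 hh)) m hm with hx | hy
    · exact hx i
    · exfalso
      have h' := weight_eq_degree_of_inr m hy
      omega
  · rintro f ⟨hy, hp⟩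
    exact ⟨harmonics_eq_sup (K := K) (ιx := ιx) (ιy := ιy) ▸ Submodule.mem_sup_right hy, hp⟩

/-- **`𝔥(λ)` for `k = 1`, weight zero**: `𝔥 ∩ ℂ[X](λ₀)` is the line of constants (`τ(λ₀)` trivial).
[cite: KashiwaraVergne1978, III (5.5), p. 42] -/
theorem harmonics_inf_piece_zero [CharZero K] :
    harmonics ⊓ piece (K := K) (ιx := ιx) (ιy := ιy) 0 =
      Submodule.span K {(1 : MvPolynomial (ιx ⊕ ιy) K)} := by
  apply le_antisymm
  · rintro f ⟨hh, hp⟩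
    have hpure := (isPluriharmonic_iff_support f).1 ((mem_harmonics_iff f).1 hh)
    have hzero : ∀ m ∈ f.support, m = 0 := by
      intro m hm
      have hw : weight kvWeight m = 0 := hp (MvPolynomial.mem_support_iff.mp hm)
      rcases hpure m hm with hx | hy
      · have h' := weight_eq_neg_degree_of_inl m hx
        exact (Finsupp.degree_eq_zero_iff m).1 (by omega)
      · have h' := weight_eq_degree_of_inr m hy
        exact (Finsupp.degree_eq_zero_iff m).1 (by omega)
    rw [f.as_sum]
    refine Submodule.sum_mem _ fun m hm => ?_
    rw [hzero m hm, ← C_apply, C_eq_smul_one]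
    exact Submodule.smul_mem _ _ (Submodule.mem_span_singleton_self _)
  · rw [Submodule.span_le, Set.singleton_subset_iff]
    refine ⟨(mem_harmonics_iff _).2 ?_, ?_⟩
    · rw [show (1 : MvPolynomial (ιx ⊕ ιy) K) = monomial 0 1 from rfl]
      exact isPluriharmonic_monomial_of_inr 0 1 fun _ => rfl
    · exact isWeightedHomogeneous_one K kvWeight

/-- **KV's `Σ` for `k = 1` is all of `ℤ` (when there is at least one `x`- and one `y`-variable)** —
Thm (6.3)(a) at `k = 1`: every piece `𝔥(λ_{−d})` is non-zero, witnessed by `x_i^d` (`d ≥ 0`) resp.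
`y_j^{−d}` (`d ≤ 0`). [cite: KashiwaraVergne1978, III (5.5), p. 42; Thm (6.3)(a), p. 44] -/
theorem harmonics_inf_piece_ne_bot [Nonempty ιx] [Nonempty ιy] (d : ℤ) :
    harmonics ⊓ piece (K := K) (ιx := ιx) (ιy := ιy) d ≠ ⊥ := by
  obtain ⟨i⟩ := ‹Nonempty ιx›
  obtain ⟨j⟩ := ‹Nonempty ιy›
  rw [Submodule.ne_bot_iff]
  rcases le_or_gt 0 d with hd | hd
  · -- witness `x_i ^ d`
    refine ⟨monomial (single (Sum.inl i : ιx ⊕ ιy) d.toNat) 1, ⟨?_, ?_⟩, ?_⟩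
    · exact (mem_harmonics_iff _).2
        (isPluriharmonic_monomial_of_inr _ _ fun j' => single_eq_of_ne Sum.inr_ne_inl)
    · have h := monomial_mem_piece (K := K) (single (Sum.inl i : ιx ⊕ ιy) d.toNat) 1
      rwa [weight_single, kvWeight_inl, nsmul_eq_mul, mul_one, Int.toNat_of_nonneg hd] at h
    · exact (monomial_eq_zero).not.2 one_ne_zero
  · -- witness `y_j ^ (-d)`
    refine ⟨monomial (single (Sum.inr j : ιx ⊕ ιy) (-d).toNat) 1, ⟨?_, ?_⟩, ?_⟩
    · exact (mem_harmonics_iff _).2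
        (isPluriharmonic_monomial_of_inl _ _ fun i' => single_eq_of_ne Sum.inl_ne_inr)
    · have h := monomial_mem_piece (K := K) (single (Sum.inr j : ιx ⊕ ιy) (-d).toNat) 1
      rwa [weight_single, kvWeight_inr, nsmul_eq_mul, mul_neg, mul_one,
        Int.toNat_of_nonneg (by omega : 0 ≤ -d), neg_neg] at h
    · exact (monomial_eq_zero).not.2 one_ne_zero

end KVPoly

end Literature.RepresentationTheory.KashiwaraVergne1978
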